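import Literature.NumberTheory.Automorphic.UnramifiedEigencharactersRankOne
import Literature.NumberTheory.Automorphic.UnitaryRankOneUnramifiedCharacters
import HarnessLib

/-!
# The unramified characters of `ℋ(U(3)(E_w), K₀; ℂ)` and `ℋ(U(2)(E_w), K₀; ℂ)` at every inert unramified place of a
# quadratic extension of number fields: every character is a `λ_β`, `λ_{β'} = λ_β ⟺ z' ∈ {z, z⁻¹}`, and `ℋ = ℂ[T₁]`
# (Cartier §IV Cor. 4.2; Rogawski §4.5; Mínguez §4)

Topic `NumberTheory/Automorphic`; namespace `Literature.NumberTheory.Automorphic.UnitaryGroup` (lane `lit-hodgefound`, Track 2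
foundations; seat `lit-hodgefound-p11`, generation 47, row g47-#10).  THEOREMS ONLY: no definition, no named fact, no instance,
no notation.  PACKAGES at the places of a number field the local rank-one classification of `UnitaryRankOneUnramifiedCharacters`
(g46-#5: `exists_heckeEigencharacter_eq_three/two` — every `ℂ`-algebra character of `ℋ(U(3), K₀)`, `ℋ(U(2), K₀)` is a Hecke
eigencharacter `λ_β`; `exists_generator_three/two` — `ℋ = ℂ[T₁]`) and of `UnramifiedEigencharactersRankOne` (g47-#8:
`unitaryHeckeEigencharacterAdic_eq_iff_three/two`), for the place-indexed eigencharacters `unitaryHeckeEigencharacterAdic c hc1 v w hw hv`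
of `HyperspecialUnitarySatakeTransformAdicCompletion` (g37-#17), the hypothesis `σ_w ≠ id` being `exists_galAdicCompletionMap_ne`
(g47-#6) and `Finite 𝓀[E_w]` being `finite_residueField_adicCompletion`.

## The mathematics

`E/F` a quadratic extension of number fields with non-trivial automorphism `c`, `w | v` a finite place of `E` fixed by `c`
with `v` unramified in `E`; `U(N)(E_w/F_v) = U(σ_w, J₀)(E_w)`, `K₀` hyperspecial, `ℋ_w = ℋ(U(N)(E_w), K₀; ℂ)`, `N ∈ {2, 3}`
(relative rank one).  Then (Cartier Cor. 4.2; Rogawski §4.5: the unramified representations of `U(3)(E_w)` «correspond to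
the classes of unramified characters of `T` under conjugacy by the Weyl group»):
**(i)** every `ℂ`-algebra character `ψ : ℋ_w → ℂ` is `λ_β = unitaryHeckeEigencharacterAdic … β` for some `β ∈ (ℂˣ)^N`;
**(ii)** `λ_{β'} = λ_β ⟺ z' = z ∨ z' = z⁻¹`, `z = β₀/β₂` (`N = 3`), `z = β₀/β₁` (`N = 2`) (g47-#8); so
`Hom_{ℂ-alg}(ℋ_w, ℂ) ≅ ℂˣ/(z ∼ z⁻¹) ≅ ℂ` via `ψ ↦ z + z⁻¹`; **(iii)** `ℋ_w = ℂ[T₁]` for one Hecke operator `T₁`.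

## What is formalised (theorems only)

* **`exists_eq_unitaryHeckeEigencharacterAdic_three`**, **`exists_eq_unitaryHeckeEigencharacterAdic_two`** ((i));
* `unitaryHeckeEigencharacterAdic_surjective_and_eq_iff_three/two` ((i) ∧ (ii) packaged);
* **`exists_generator_unitaryHeckeAlgebraAdic_three/two`** ((iii): `∃ T₁, ∀ T, ∃ P, aeval T₁ P = T`).

## References
* [CartierCorvallis1979] P. Cartier, *Representations of 𝔭-adic groups: a survey*, PSPM 33.1 (1979), §IV Thm. 4.1, Cor. 4.2.
* [Rogawski1990] J. D. Rogawski, *Automorphic Representations of Unitary Groups in Three Variables* (1990), §2.3 p. 21, §4.5 p. 50.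
* [Minguez2011] A. Mínguez, *Unramified representations of unitary groups* (2011), §4.
-/

noncomputable section

open scoped Valued WithZero Matrix MatrixGroups
open Matrix MonoidAlgebra Representation NumberField IsDedekindDomain Polynomial

namespace Literature.NumberTheory.Automorphic.UnitaryGroup

open Literature.NumberTheory.Automorphic.HermitianLattice Literature.NumberTheory.Automorphic

variable {F E : Type} [Field F] [NumberField F] [Field E] [NumberField E] [Algebra F E] [Algebra.IsQuadraticExtension F E]
  (c : E ≃ₐ[F] E) (hc1 : c ≠ 1) (v : HeightOneSpectrum (𝓞 F)) (w : PlacesOver E v) (hw : c • w.1 = w.1)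
  (hv : Algebra.IsUnramifiedIn (𝓞 E) v.asIdeal)

/-! ## `U(3)(E_w/F_v)` -/

/-- **EVERY `ℂ`-CHARACTER OF `ℋ(U(3)(E_w), K₀; ℂ)` IS AN UNRAMIFIED EIGENCHARACTER `λ_β`** at every inert unramified place
(g46-#5 at `E_w`). [cite: CartierCorvallis1979, §IV Cor. 4.2] [cite: Rogawski1990, §4.5 p. 50] [cite: Minguez2011, §4] -/
theorem exists_eq_unitaryHeckeEigencharacterAdic_three
    (ψ : heckeAlgebra ℂ (unitaryGroupOfForm (galAdicCompletionMap (L := E) c hw)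
        ((StdForm.antidiagonal 3).over (w.1.adicCompletion E)))
      (unitaryInt (galAdicCompletionMap (L := E) c hw) ((StdForm.antidiagonal 3).over (w.1.adicCompletion E))) →ₐ[ℂ] ℂ) :
    ∃ β : Fin 3 → ℂˣ, ψ = unitaryHeckeEigencharacterAdic c hc1 v w hw hv β := by
  haveI := finite_residueField_adicCompletion E w.1
  haveI := isHeckeTriple_unitaryInt_adicCompletion c v w hw ((StdForm.antidiagonal 3).over (w.1.adicCompletion E))
  obtain ⟨β, hβ⟩ := (unramifiedLocalConjDatum_localConjUniformizer c hc1 v w hw hv).exists_heckeEigencharacter_eq_three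
    (exists_galAdicCompletionMap_ne c hc1 v w hw) ψ
  refine ⟨β, ?_⟩
  rw [unitaryHeckeEigencharacterAdic_eq c hc1 v w hw hv (unramifiedLocalConjDatum_localConjUniformizer c hc1 v w hw hv), hβ]

/-- **CARTIER'S COROLLARY 4.2 FOR `U(3)(E_w/F_v)`**: the `ℂ`-characters of `ℋ(U(3)(E_w), K₀; ℂ)` are exactly the `λ_β`,
`β ∈ (ℂˣ)³`, and `λ_{β'} = λ_β ⟺ β'₀/β'₂ ∈ {β₀/β₂, β₂/β₀}` — `Hom(ℋ_w, ℂ) ≅ ℂˣ/(z ∼ z⁻¹)`, at every inert unramified place.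
[cite: CartierCorvallis1979, §IV Thm. 4.1, Cor. 4.2] [cite: Rogawski1990, §2.3 p. 21, §4.5 p. 50] -/
theorem unitaryHeckeEigencharacterAdic_surjective_and_eq_iff_three :
    (∀ ψ : heckeAlgebra ℂ (unitaryGroupOfForm (galAdicCompletionMap (L := E) c hw)
          ((StdForm.antidiagonal 3).over (w.1.adicCompletion E)))
        (unitaryInt (galAdicCompletionMap (L := E) c hw) ((StdForm.antidiagonal 3).over (w.1.adicCompletion E))) →ₐ[ℂ] ℂ,
        ∃ β : Fin 3 → ℂˣ, ψ = unitaryHeckeEigencharacterAdic c hc1 v w hw hv β) ∧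
      ∀ β β' : Fin 3 → ℂˣ,
        unitaryHeckeEigencharacterAdic c hc1 v w hw hv β' = unitaryHeckeEigencharacterAdic c hc1 v w hw hv β ↔
          (β' 0 / β' 2 = β 0 / β 2 ∨ β' 0 / β' 2 = (β 0 / β 2)⁻¹) :=
  ⟨exists_eq_unitaryHeckeEigencharacterAdic_three c hc1 v w hw hv, unitaryHeckeEigencharacterAdic_eq_iff_three c hc1 v w hw hv⟩

include hc1 hv in
/-- **`ℋ(U(3)(E_w), K₀; ℂ) = ℂ[T₁]`**: at every inert unramified place there is one Hecke operator `T₁` of which every Hecke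
operator is a polynomial (g46-#5 at `E_w`). [cite: CartierCorvallis1979, §IV Thm. 4.1] [cite: Rogawski1990, §4.5 p. 50] -/
theorem exists_generator_unitaryHeckeAlgebraAdic_three :
    ∃ T₁ : heckeAlgebra ℂ (unitaryGroupOfForm (galAdicCompletionMap (L := E) c hw)
        ((StdForm.antidiagonal 3).over (w.1.adicCompletion E)))
      (unitaryInt (galAdicCompletionMap (L := E) c hw) ((StdForm.antidiagonal 3).over (w.1.adicCompletion E))),
      ∀ T, ∃ P : ℂ[X], aeval T₁ P = T := by
  haveI := finite_residueField_adicCompletion E w.1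
  haveI := isHeckeTriple_unitaryInt_adicCompletion c v w hw ((StdForm.antidiagonal 3).over (w.1.adicCompletion E))
  obtain ⟨T₁, -, hT₁⟩ := (unramifiedLocalConjDatum_localConjUniformizer c hc1 v w hw hv).exists_generator_three
    (exists_galAdicCompletionMap_ne c hc1 v w hw)
  exact ⟨T₁, hT₁⟩

/-! ## `U(2)(E_w/F_v)` -/

/-- **EVERY `ℂ`-CHARACTER OF `ℋ(U(2)(E_w), K₀; ℂ)` IS AN UNRAMIFIED EIGENCHARACTER `λ_β`** at every inert unramified place.
[cite: CartierCorvallis1979, §IV Cor. 4.2] [cite: Rogawski1990, §4.5 p. 50] [cite: Minguez2011, §4] -/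
theorem exists_eq_unitaryHeckeEigencharacterAdic_two
    (ψ : heckeAlgebra ℂ (unitaryGroupOfForm (galAdicCompletionMap (L := E) c hw)
        ((StdForm.antidiagonal 2).over (w.1.adicCompletion E)))
      (unitaryInt (galAdicCompletionMap (L := E) c hw) ((StdForm.antidiagonal 2).over (w.1.adicCompletion E))) →ₐ[ℂ] ℂ) :
    ∃ β : Fin 2 → ℂˣ, ψ = unitaryHeckeEigencharacterAdic c hc1 v w hw hv β := by
  haveI := finite_residueField_adicCompletion E w.1
  haveI := isHeckeTriple_unitaryInt_adicCompletion c v w hw ((StdForm.antidiagonal 2).over (w.1.adicCompletion E))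
  obtain ⟨β, hβ⟩ := (unramifiedLocalConjDatum_localConjUniformizer c hc1 v w hw hv).exists_heckeEigencharacter_eq_two
    (exists_galAdicCompletionMap_ne c hc1 v w hw) ψ
  refine ⟨β, ?_⟩
  rw [unitaryHeckeEigencharacterAdic_eq c hc1 v w hw hv (unramifiedLocalConjDatum_localConjUniformizer c hc1 v w hw hv), hβ]

/-- **CARTIER'S COROLLARY 4.2 FOR `U(2)(E_w/F_v)`**: the `ℂ`-characters of `ℋ(U(2)(E_w), K₀; ℂ)` are exactly the `λ_β`, and
`λ_{β'} = λ_β ⟺ β'₀/β'₁ ∈ {β₀/β₁, β₁/β₀}`, at every inert unramified place. [cite: CartierCorvallis1979, §IV Thm. 4.1, Cor. 4.2]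
[cite: Rogawski1990, §4.5 p. 50] -/
theorem unitaryHeckeEigencharacterAdic_surjective_and_eq_iff_two :
    (∀ ψ : heckeAlgebra ℂ (unitaryGroupOfForm (galAdicCompletionMap (L := E) c hw)
          ((StdForm.antidiagonal 2).over (w.1.adicCompletion E)))
        (unitaryInt (galAdicCompletionMap (L := E) c hw) ((StdForm.antidiagonal 2).over (w.1.adicCompletion E))) →ₐ[ℂ] ℂ,
        ∃ β : Fin 2 → ℂˣ, ψ = unitaryHeckeEigencharacterAdic c hc1 v w hw hv β) ∧
      ∀ β β' : Fin 2 → ℂˣ,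
        unitaryHeckeEigencharacterAdic c hc1 v w hw hv β' = unitaryHeckeEigencharacterAdic c hc1 v w hw hv β ↔
          (β' 0 / β' 1 = β 0 / β 1 ∨ β' 0 / β' 1 = (β 0 / β 1)⁻¹) :=
  ⟨exists_eq_unitaryHeckeEigencharacterAdic_two c hc1 v w hw hv, unitaryHeckeEigencharacterAdic_eq_iff_two c hc1 v w hw hv⟩

include hc1 hv in
/-- **`ℋ(U(2)(E_w), K₀; ℂ) = ℂ[T₁]`** at every inert unramified place. [cite: CartierCorvallis1979, §IV Thm. 4.1]
[cite: Rogawski1990, §4.5 p. 50] -/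
theorem exists_generator_unitaryHeckeAlgebraAdic_two :
    ∃ T₁ : heckeAlgebra ℂ (unitaryGroupOfForm (galAdicCompletionMap (L := E) c hw)
        ((StdForm.antidiagonal 2).over (w.1.adicCompletion E)))
      (unitaryInt (galAdicCompletionMap (L := E) c hw) ((StdForm.antidiagonal 2).over (w.1.adicCompletion E))),
      ∀ T, ∃ P : ℂ[X], aeval T₁ P = T := by
  haveI := finite_residueField_adicCompletion E w.1
  haveI := isHeckeTriple_unitaryInt_adicCompletion c v w hw ((StdForm.antidiagonal 2).over (w.1.adicCompletion E))
  obtain ⟨T₁, -, hT₁⟩ := (unramifiedLocalConjDatum_localConjUniformizer c hc1 v w hw hv).exists_generator_two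
    (exists_galAdicCompletionMap_ne c hc1 v w hw)
  exact ⟨T₁, hT₁⟩

end Literature.NumberTheory.Automorphic.UnitaryGroup
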